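import Summits.NavierStokesRegularity.FluidComputer.FrameClosure
import Summits.NavierStokesRegularity.FluidComputer.Reparam
import Mathlib.Data.Matrix.Mul
import Mathlib.Analysis.Calculus.Deriv.Mul
import Mathlib.Analysis.Calculus.Deriv.Comp
import HarnessLib

/-!
# The row model: per-row soundness of the ramp-enclosure kernel (layer A of `structure Row`;
# `pub-fluidc-bp3/R1-DESIGN.md` §7.1–§7.3, §7.11 (2), §8.8 (2))

HONEST FRAMING (cell `pub-fluidc`, blueprint seat bp3, gen 20): low prior, high value-of-information
experiment on Tao's machine paradigm; NOT a claim that NS blows up. Pure real analysis, continuing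
`FrameClosure.lean`, `ImplicitMajorantRow.lean` and `Reparam.lean`.

WHAT THIS FILE IS. The kernel of record (`kgen19.py`, chain k52) certifies, row by row, that every
member `y` of the E-scaled defect class around the reference polynomial orbit `x̂` stays in the tube
`|A(t)(y∘s − x̂)(t)| ≤ W̄`, `|y∘s − x̂| ≤ Ē` under the phase lock `y_p(s(t)) = x̂_p(t)`. Its per-row check
(`row_check`) is six families of table inequalities. This file is the ANALYTIC half of the per-row
soundness theorem: `RowModel` collects the data of one row (field with its Taylor split along the
reference, reference orbit and Jacobian table, frames `A, Ȧ, T̂`, residual `R`, member, phase map, and the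
real tables), `RowModel.Cert` lists — as hypotheses over `ℝ` — exactly the inequalities the table layer
(`structure Row`, dyadic, `decide`) has to deliver, `RowModel.MemberOn Ts` the genuine assumptions on the
member on the part `[T₀, Ts]` of the row reached so far, and `RowModel.row_sound_on` / `RowModel.row_sound`
(`Ts = T₁`) conclude the tube bounds on `[T₀, Ts]`, the block-end bounds `|z| ≤ ub j` (the carried `u`),
and the phase-rate bound `|ṡ − 1| ≤ ρ`. No inverse, no operator norm, no `exp` of a
matrix enters; the start-of-row auxiliary bound `|e(T₀)| ≤ Ē` is DERIVED (`start_aux_bound`, a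
sub/super-solution comparison), so the only quantity carried between rows is `u` — as in the kernel.

THE IDENTITY (R1-DESIGN §7.1, in reference time `t`; `e := y∘s − x̂`, `z := A e`, `Φ̃ := x̂'_p`,
`Ṽ := J e + Q(e) + δF∘s − d`, `d := x̂' − F(x̂)` the reference defect, `P̃ := I − x̂' e_pᵀ/Φ̃`):
the lock forces `ṡ (Φ̃ + Ṽ_p) = Φ̃` (derivative uniqueness on `[t, T₁]`), hence `ė = ṡ P̃ Ṽ`
(`Reparam.equalPhase_identity`) and, with the tabulated reconstruction `e = T̂ z + R e` (`e_p = 0`),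
`ż = (ȦT̂ + ṡ AP̃JT̂) z + (ȦR + ṡ AP̃JR) e + ṡ AP̃ (Q(e) + δF − d)`. The coefficient is hulled over
`ṡ ∈ [1 − ρ, 1 + ρ]` into `B` (hypothesis `hKB`), the forcing is bounded by `φ = CF·Ē + (1+ρ)·APm·(FQ + δ + DB)`
(`hCF`, `hAPm`, `hφ`) AS LONG AS `|e| ≤ Ē`, and `|ṡ − 1| ≤ D_p/(Φlo − D_p) ≤ ρ` (`hDp`, `hρ`). The a-priori
closure of `|e| ≤ Ē` together with `|z| ≤ W̄` is `closureBlock` (the variant of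
`ImplicitMajorant.rowClosureAux` with the coefficient bound ALSO conditional and the phase exception
`Ē_p = 0`), block by block (`2^m` blocks of `2^(S−m)` substeps: decayed chain `Ad, bd` for the block end,
no-decay chain `An, bn` for the interior), `row_sound_on` by induction over the blocks (`blocks_on`).

MODEL SEMANTICS (documented choices). The member solves `ẏ = F(y) + δF` with a two-sided derivative on an
open set `D ⊇ s([T₀, Ts])` of its own clock; the phase map `s` is GIVEN (continuous on `[T₀, Ts]`, right
derivative `ṡ`, lock) — its existence / continuation is a separate statement (layer A′, `PhaseLock`), which is
why everything here is stated on the part `[T₀, Ts]`, `T₀ ≤ Ts ≤ T₁`, of a row reached so far (a bootstrap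
in `Ts` continues `s`; a row may also end at a member's own section crossing). The defect class is the
E-scaled one: `|δF(s(t))| ≤ δ` is required only while `|e(t)| ≤ Ē`.

FILES. For the 400-line rule of the topic directory the text is four files, one namespace
`Summit.NavierStokesRegularity.FluidComputer.RowModel` throughout: `RowModel` (§1: the model and the two
hypothesis records `MemberOn`, `Cert`), `RowModelClosure` (§0: generic helpers and `closureBlock`),
`RowModelIdentity` (§2: regularity, the identities and the bounds inside the tube), `RowModelSound` (§3: the
block induction and the row theorems `row_sound_on`, `row_sound`, `row_end`, `row_sd_eq`).

[cite: Tao2016AveragedNS, §5.5 Thm 5.3 (5.5)]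
-/

noncomputable section

namespace Summit.NavierStokesRegularity.FluidComputer

open Set Real Filter Topology Matrix

/-! ### §1 The data of one row -/

/-- **The data of one row** of the implicit machine (R1-DESIGN §7.3), over slot index `ι` (frame
coordinates `z`) and state index `κ` (coefficients, among them the phase coordinate `p`). Time is the
REFERENCE time `t ∈ [T₀, T₁]`, `T₁ = T₀ + nb · 2^S · h` (`nb` blocks of `2^S` substeps of length `h`).
Field: `F` with its exact Taylor split along the reference, `F(x̂(t) + v) = F(x̂(t)) + Jm(t) v + Q(v)`.
Reference: `x̂ = xh` with derivative `xh'`. Frames: slot rows `Am(t)` (derivative `Am'`), slot columns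
`G(t)` of the approximate inverse `T̂`, residual `Rr(t)` (`= I − T̂Â`; only the reconstruction identity
`hrec` is used). Member: `y` solving `ẏ = F(y) + δF` on `D`, phase map `s` with right derivative `sd`
(hypotheses on them: `MemberOn`).
Tables (reals; the table layer instantiates them by dyadics): contraction rate `c`, `η ≥ e^{−ch}`,
`η' ≥ e^{ch}`, phase-rate radius `ρ`, phase-speed floor `Φlo`, coefficient hull `B`, resolvent majorant
`E`, forcing `φ`, boxes `W̄`, `Ē`, quadratic bound `FQ`, defect class `δ`, reference defect `DB`, phase
Jacobian row `Jpm`, forcing tables `CF`, `APm`, reconstruction tables `Gm`, `Rm`, the decayed / no-decay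
squaring chains `Ad, bd` / `An, bn`, and the block-start table `ub` (`ub 0 = u`, the carried start box).
[folklore] -/
structure RowModel (ι κ : Type*) where
  /-- phase coordinate -/
  p : κ
  /-- row start (reference time) -/
  T₀ : ℝ
  /-- substep -/
  h : ℝ
  /-- squarings per block (`2^S` substeps per block) -/
  S : ℕ
  /-- number of blocks -/
  nb : ℕ
  /-- the field -/
  F : (κ → ℝ) → κ → ℝ
  /-- its quadratic remainder along the reference -/
  Q : (κ → ℝ) → κ → ℝ
  /-- reference orbit -/
  xh : ℝ → κ → ℝ
  /-- its derivative -/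
  xh' : ℝ → κ → ℝ
  /-- Jacobian of `F` along the reference -/
  Jm : ℝ → Matrix κ κ ℝ
  /-- slot rows of the frame `A(t)` -/
  Am : ℝ → Matrix ι κ ℝ
  /-- their derivative -/
  Am' : ℝ → Matrix ι κ ℝ
  /-- slot columns of the approximate inverse `T̂(t)` -/
  G : ℝ → Matrix κ ι ℝ
  /-- residual `R(t) = I − T̂Â` -/
  Rr : ℝ → Matrix κ κ ℝ
  /-- the member, in its own clock -/
  y : ℝ → κ → ℝ
  /-- its defect `ẏ − F(y)` -/
  δF : ℝ → κ → ℝ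
  /-- where the member is differentiable -/
  D : Set ℝ
  /-- phase map (reference time ↦ member time) -/
  s : ℝ → ℝ
  /-- its right derivative -/
  sd : ℝ → ℝ
  /-- contraction rate of the row -/
  c : ℝ
  /-- `η ≥ exp (−c h)` -/
  η : ℝ
  /-- `η' ≥ exp (c h)` -/
  η' : ℝ
  /-- phase-rate radius: `|ṡ − 1| ≤ ρ` -/
  ρ : ℝ
  /-- floor of the reference phase speed `|x̂'_p|` -/
  Φlo : ℝ
  /-- coefficient hull: `|K + cI| ≤ B` -/
  B : Matrix ι ι ℝ
  /-- resolvent majorant: `(I − hB)E ≥ I` -/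
  E : Matrix ι ι ℝ
  /-- forcing bound -/
  φ : ι → ℝ
  /-- a-priori frame box -/
  Wbar : ι → ℝ
  /-- a-priori deviation box (`Ē_p = 0` allowed) -/
  Ebar : κ → ℝ
  /-- `|Q(v)| ≤ FQ` on `|v| ≤ Ē` -/
  FQ : κ → ℝ
  /-- defect class radius -/
  δ : κ → ℝ
  /-- reference defect bound `|x̂' − F(x̂)| ≤ DB` -/
  DB : κ → ℝ
  /-- `|Jm p ·| ≤ Jpm` -/
  Jpm : κ → ℝ
  /-- `|ȦR| + (1+ρ)|AP̃JR| ≤ CF` -/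
  CF : Matrix ι κ ℝ
  /-- `|AP̃| ≤ APm` -/
  APm : Matrix ι κ ℝ
  /-- `|G| ≤ Gm` -/
  Gm : Matrix κ ι ℝ
  /-- `|Rr| ≤ Rm` -/
  Rm : Matrix κ κ ℝ
  /-- decayed squaring chain (block end) -/
  Ad : ℕ → Matrix ι ι ℝ
  /-- its affine part -/
  bd : ℕ → ι → ℝ
  /-- no-decay squaring chain (block interior) -/
  An : ℕ → Matrix ι ι ℝ
  /-- its affine part -/
  bn : ℕ → ι → ℝ
  /-- block-start boxes, `ub 0 = u` -/
  ub : ℕ → ι → ℝ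

namespace RowModel

variable {ι : Type*} {κ : Type*} [Fintype ι] [Fintype κ] (R : RowModel ι κ)

/-- Block length `2^S h`. [folklore] -/
def Hb : ℝ := 2 ^ R.S * R.h

/-- Row end `T₁ = T₀ + nb · 2^S h`. [folklore] -/
def T₁ : ℝ := R.T₀ + (R.nb : ℝ) * R.Hb

/-- Deviation in reference time: `e(t) = y(s(t)) − x̂(t)`. [folklore] -/
def e (t : ℝ) (a : κ) : ℝ := R.y (R.s t) a - R.xh t a

/-- Frame coordinates `z(t) = A(t) e(t)` (slot rows only). [folklore] -/
def z (t : ℝ) : ι → ℝ := R.Am t *ᵥ R.e t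

/-- Reference defect `d = x̂' − F(x̂)`. [folklore] -/
def d (t : ℝ) (a : κ) : ℝ := R.xh' t a - R.F (R.xh t) a

/-- Inhomogeneity `w = Q(e) + δF∘s − d`. [folklore] -/
def w (t : ℝ) (a : κ) : ℝ := R.Q (R.e t) a + R.δF (R.s t) a - R.d t a

/-- `Ṽ = Jm e + w`, so that `ẏ(s(t)) + … = x̂' + Ṽ` (`Fy_add`). [folklore] -/
def Vt (t : ℝ) : κ → ℝ := R.Jm t *ᵥ R.e t + R.w t

/-- `ė` in reference time: `ṡ (F(y∘s) + δF∘s) − x̂'`. [folklore] -/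
def ed (t : ℝ) (a : κ) : ℝ := R.sd t * (R.F (R.y (R.s t)) a + R.δF (R.s t) a) - R.xh' t a

/-- `ż = Ȧ e + A ė`. [folklore] -/
def zd (t : ℝ) : ι → ℝ := R.Am' t *ᵥ R.e t + R.Am t *ᵥ R.ed t

/-- `K₀ = ȦG` (the `ṡ`-free part of the coefficient). [folklore] -/
def K0 (t : ℝ) : Matrix ι ι ℝ := R.Am' t * R.G t

/-- `ȦR`. [folklore] -/
def AmR (t : ℝ) : Matrix ι κ ℝ := R.Am' t * R.Rr t

/-- The phase radius `D_p = Σ_b Jpm b Ē b + FQ p + δ p + DB p ≥ |Ṽ_p|`. [folklore] -/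
def Dp : ℝ := ∑ b, R.Jpm b * R.Ebar b + R.FQ R.p + R.δ R.p + R.DB R.p

/-- **The member hypotheses** (genuine assumptions) on the part `[T₀, Ts]` of the row reached so far
(`Ts = T₁` for the full row; the extent is a parameter so that the phase map can be CONTINUED by a
bootstrap — layer A′ — and so that a row may end at a member's own section crossing): `y` solves
`ẏ = F(y) + δF` on `D` (two-sided derivative), the phase map is continuous on `[T₀, Ts]` with right
derivative `sd` on `[T₀, Ts)`, maps into `D`, locks the phase `y_p(s(t)) = x̂_p(t)`, and the defect is in
the E-scaled class `|δF(s(t))| ≤ δ` while `|e(t)| ≤ Ē`. A proof-carrying record (deliberately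
`Type`-valued: a bundle of hypotheses of `row_sound`, not a named proposition of the tree). [folklore] -/
structure MemberOn (Ts : ℝ) : Type where
  /-- the ODE with defect -/
  hy : ∀ σ ∈ R.D, ∀ a, HasDerivAt (fun r => R.y r a) (R.F (R.y σ) a + R.δF σ a) σ
  /-- continuity of the phase map -/
  hsc : ContinuousOn R.s (Icc R.T₀ Ts)
  /-- its right derivative -/
  hsd : ∀ t ∈ Ico R.T₀ Ts, HasDerivWithinAt R.s (R.sd t) (Ici t) t
  /-- it maps into `D` -/
  hsD : ∀ t ∈ Icc R.T₀ Ts, R.s t ∈ R.D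
  /-- the phase lock -/
  hlock : ∀ t ∈ Icc R.T₀ Ts, R.y (R.s t) R.p = R.xh t R.p
  /-- the E-scaled defect class -/
  hδ : ∀ t ∈ Icc R.T₀ Ts, (∀ a, |R.e t a| ≤ R.Ebar a) → ∀ a, |R.δF (R.s t) a| ≤ R.δ a

variable {R} in
omit [Fintype ι] [Fintype κ] in
/-- `y(s(t)) = x̂(t) + e(t)`. [folklore] -/
theorem y_eq (t : ℝ) : R.y (R.s t) = R.xh t + R.e t := by
  ext a; simp only [Pi.add_apply, RowModel.e]; ring

variable {R} in
omit [Fintype ι] [Fintype κ] in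
/-- The lock in deviation form: `e_p ≡ 0` on the row. [folklore] -/
theorem e_phase {Ts : ℝ} (hm : R.MemberOn Ts) {t : ℝ} (ht : t ∈ Icc R.T₀ Ts) :
    R.e t R.p = 0 := by
  simp only [RowModel.e, hm.hlock t ht, sub_self]

variable [DecidableEq κ]

/-- The tangential projector of the lock, `P̃ = I − x̂' e_pᵀ / x̂'_p`. [folklore] -/
def Pt (t : ℝ) : Matrix κ κ ℝ := fun a b =>
  (if a = b then 1 else 0) - R.xh' t a * (if b = R.p then (R.xh' t R.p)⁻¹ else 0)

/-- `AP̃`. [folklore] -/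
def APt (t : ℝ) : Matrix ι κ ℝ := R.Am t * R.Pt t

/-- `AP̃J`. [folklore] -/
def APJ (t : ℝ) : Matrix ι κ ℝ := R.APt t * R.Jm t

/-- `M = AP̃JG` (the `ṡ`-part of the coefficient). [folklore] -/
def M (t : ℝ) : Matrix ι ι ℝ := R.APJ t * R.G t

/-- `AP̃JR`. [folklore] -/
def APJR (t : ℝ) : Matrix ι κ ℝ := R.APJ t * R.Rr t

/-- The coefficient `K(t) = ȦG + ṡ AP̃JG`. [folklore] -/
def Kf (t : ℝ) : Matrix ι ι ℝ := R.K0 t + R.sd t • R.M t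

/-- The forcing, DEFINED as the remainder `ż − K z` (its bound is the content, `f_le`). [folklore] -/
def f (t : ℝ) : ι → ℝ := R.zd t - R.Kf t *ᵥ R.z t

variable {R} in
omit [Fintype ι] in
/-- `(P̃ V)_a = V_a − x̂'_a V_p / x̂'_p`. [folklore] -/
theorem Pt_mulVec (t : ℝ) (V : κ → ℝ) (a : κ) :
    (R.Pt t *ᵥ V) a = V a - R.xh' t a * V R.p / R.xh' t R.p := by
  rw [Matrix.mulVec_apply_eq_sum]
  simp only [RowModel.Pt, sub_mul, Finset.sum_sub_distrib, ite_mul, one_mul, zero_mul,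
    Finset.sum_ite_eq, Finset.mem_univ, if_true, mul_ite, mul_zero, Finset.sum_ite_eq']
  ring

variable [DecidableEq ι]

/-- **What the table layer certifies** (R1-DESIGN §7.3, the six checks and their inputs, as real
inequalities; each is an entrywise dyadic `decide` in `structure Row`): analytic facts about the
reference and the frames on the row (`hxh`, `hA`, `hF`, `hQ`, `hrec`, the enclosures `hΦ … hAPm`, all from
interval evaluation of polynomials), the phase-rate budget (`hDp`, `hρ`), the forcing table (`hφ`), the
resolvent majorant (`hIE`), the two squaring chains, the block table (`hub`, `hsup`) and the strict closure
row (`hEbar`, off `p`). A proof-carrying record (`Type`-valued, like `MemberOn`): exactly the hypothesis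
list of `row_sound` that `Row.check = true` must imply, nothing is asserted. [folklore] -/
structure Cert : Type where
  /-- positive substep -/
  hh : 0 < R.h
  /-- at least one block -/
  hnb : 0 < R.nb
  /-- nonnegative rate -/
  hc : 0 ≤ R.c
  /-- nonnegative phase-rate radius -/
  hρ0 : 0 ≤ R.ρ
  /-- the reference is differentiable -/
  hxh : ∀ t a, HasDerivAt (fun r => R.xh r a) (R.xh' t a) t
  /-- the frame is differentiable -/
  hA : ∀ t i b, HasDerivAt (fun r => R.Am r i b) (R.Am' t i b) t
  /-- exact Taylor split of the field along the reference -/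
  hF : ∀ t (v : κ → ℝ), R.F (R.xh t + v) = R.F (R.xh t) + R.Jm t *ᵥ v + R.Q v
  /-- quadratic remainder bound on the box -/
  hQ : ∀ v : κ → ℝ, (∀ b, |v b| ≤ R.Ebar b) → ∀ a, |R.Q v a| ≤ R.FQ a
  /-- reconstruction `e = G (A e) + R e` for `e_p = 0` -/
  hrec : ∀ t ∈ Icc R.T₀ R.T₁, ∀ v : κ → ℝ, v R.p = 0 →
    R.G t *ᵥ (R.Am t *ᵥ v) + R.Rr t *ᵥ v = v
  /-- phase-speed floor -/
  hΦ : ∀ t ∈ Icc R.T₀ R.T₁, R.Φlo ≤ |R.xh' t R.p|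
  /-- reference defect -/
  hDB : ∀ t ∈ Icc R.T₀ R.T₁, ∀ a, |R.xh' t a - R.F (R.xh t) a| ≤ R.DB a
  /-- phase row of the Jacobian -/
  hJp : ∀ t ∈ Icc R.T₀ R.T₁, ∀ b, |R.Jm t R.p b| ≤ R.Jpm b
  /-- `|G| ≤ Gm` -/
  hGm : ∀ t ∈ Icc R.T₀ R.T₁, ∀ a i, |R.G t a i| ≤ R.Gm a i
  /-- `|Rr| ≤ Rm` -/
  hRm : ∀ t ∈ Icc R.T₀ R.T₁, ∀ a b, |R.Rr t a b| ≤ R.Rm a b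
  /-- the coefficient hull over `ṡ ∈ [1−ρ, 1+ρ]` -/
  hKB : ∀ t ∈ Icc R.T₀ R.T₁, ∀ r : ℝ, |r - 1| ≤ R.ρ →
    ∀ i j, |R.K0 t i j + r * R.M t i j + (if i = j then R.c else 0)| ≤ R.B i j
  /-- forcing table, `e`-part -/
  hCF : ∀ t ∈ Icc R.T₀ R.T₁, ∀ i b, |R.AmR t i b| + (1 + R.ρ) * |R.APJR t i b| ≤ R.CF i b
  /-- forcing table, `w`-part -/
  hAPm : ∀ t ∈ Icc R.T₀ R.T₁, ∀ i b, |R.APt t i b| ≤ R.APm i b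
  /-- phase budget -/
  hDp : R.Dp < R.Φlo
  /-- phase-rate radius -/
  hρ : R.Dp / (R.Φlo - R.Dp) ≤ R.ρ
  /-- the forcing bound -/
  hφ : ∀ i, ∑ b, R.CF i b * R.Ebar b + (1 + R.ρ) * ∑ b, R.APm i b * (R.FQ b + R.δ b + R.DB b)
    ≤ R.φ i
  /-- sign tables -/
  hB0 : ∀ i j, 0 ≤ R.B i j
  /-- sign tables -/
  hφ0 : ∀ i, 0 ≤ R.φ i
  /-- sign tables -/
  hEbar0 : ∀ b, 0 ≤ R.Ebar b
  /-- sign tables -/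
  hE0 : ∀ i k, 0 ≤ R.E i k
  /-- resolvent majorant `(I − hB)E ≥ I` -/
  hIE : ∀ i k, (if i = k then (1:ℝ) else 0) ≤ R.E i k - R.h * ∑ j, R.B i j * R.E j k
  /-- `η ≥ e^{−ch}` -/
  hη : exp (-(R.c * R.h)) ≤ R.η
  /-- `η' ≥ e^{ch}` -/
  hη' : exp (R.c * R.h) ≤ R.η'
  /-- decayed chain, start -/
  hAd0 : ∀ i k, R.η * R.E i k ≤ R.Ad 0 i k
  /-- decayed chain, start -/
  hbd0 : ∀ i, R.η * ∑ k, R.E i k * (R.h * (R.η' * R.φ k)) ≤ R.bd 0 i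
  /-- decayed chain, squarings -/
  hAdsq : ∀ n < R.S, ∀ i k, ∑ j, R.Ad n i j * R.Ad n j k ≤ R.Ad (n + 1) i k
  /-- decayed chain, squarings -/
  hbdsq : ∀ n < R.S, ∀ i, ∑ j, R.Ad n i j * R.bd n j + R.bd n i ≤ R.bd (n + 1) i
  /-- no-decay chain, start -/
  hAn0 : ∀ i k, R.E i k ≤ R.An 0 i k
  /-- no-decay chain, start -/
  hbn0 : ∀ i, ∑ k, R.E i k * (R.h * (R.η' * R.φ k)) ≤ R.bn 0 i
  /-- no-decay chain, squarings -/
  hAnsq : ∀ n < R.S, ∀ i k, ∑ j, R.An n i j * R.An n j k ≤ R.An (n + 1) i k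
  /-- no-decay chain, squarings -/
  hbnsq : ∀ n < R.S, ∀ i, ∑ j, R.An n i j * R.bn n j + R.bn n i ≤ R.bn (n + 1) i
  /-- no-decay chain dominates the identity -/
  hAnI : ∀ n ≤ R.S, ∀ i k, (if i = k then (1:ℝ) else 0) ≤ R.An n i k
  /-- no-decay chain, signs -/
  hbnn : ∀ n ≤ R.S, ∀ i, 0 ≤ R.bn n i
  /-- block table: `Ad ub j + bd ≤ ub (j+1)` -/
  hub : ∀ j < R.nb, ∀ i, ∑ k, R.Ad R.S i k * R.ub j k + R.bd R.S i ≤ R.ub (j + 1) i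
  /-- block table: strict interior `An ub j + bn < W̄` -/
  hsup : ∀ j < R.nb, ∀ i, ∑ k, R.An R.S i k * R.ub j k + R.bn R.S i < R.Wbar i
  /-- strict closure row off the phase coordinate -/
  hEbar : ∀ a, a ≠ R.p → ∑ i, R.Gm a i * R.Wbar i + ∑ b, R.Rm a b * R.Ebar b < R.Ebar a

end RowModel

end Summit.NavierStokesRegularity.FluidComputer
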